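import Mathlib
import Summits.MatrixMultiplication.MatrixMultiplication.Theorems.LevelGradedCohnUmansLevelOneGL2DesignsTangencyPolarityPG

/-!
# The polar form of `stub_tangencySets` is false — stub `stub_tangencySets` (crux
`LevelOneGL2Designs`, stmt-MatrixMultiplication-14080), wall-breaker axis 7/12 "Hermitian unital
constructions", generation 1, part 4 (residual in the stub's quantifier shape)

`stub_tangencySets` asks for `c > 0` and, for every `p₀`, a prime `p ≥ p₀` with a strong
representative system `S ⊆ 𝔽_p² × 𝔽_p²` (`a_f ⬝ᵥ b_{f'} = 1 ↔ f = f'`) of size `≥ c·p^{3/2}`.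
The Hermitian axis produces such systems over SQUARE fields by taking the absolute points of a
unitary polarity together with their polars.  Over the prime field the only polarities of
`PG(2,p)` are the orthogonal ones `[v] ↦ [Gv]` (`G` symmetric, `det G ≠ 0`), and
`BaerPolarity.polar_srs_card_le_zmod` (Baer's theorem, instantiated) caps a POLAR system — every
line `{x : b ⬝ᵥ x = 1}` the polar of its point, `(b, −1) ∥ G(a, 1)` — at `p + 1` flags.

* `not_polar_tangencySets` — hence the stub with the extra clause "the lines are the polars of the
  points under one non-degenerate symmetric matrix" is FALSE outright: `c·p^{3/2} ≤ p + 1` fails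
  for every prime `p > 4/c²`.  This is the axis' dead door stated, unconditionally and
  kernel-checked, in the exact quantifier shape of the stub (compare the conditional
  `FlagLine.TangencyHermitian.stub_tangencySets_false_of_primeSaving` of seat k10, which needs the
  Hunter–Pohoata–Verstraëte–Zhang prime-saving conjecture — now known to be false — as hypothesis).

What it does NOT say: nothing about non-polar systems; the stub itself is the open frontier
`IM(2,p) ≍ p^{3/2}` (Pohoata 2026: `p^{3/2−ε}`).  Elementary real-exponent bookkeeping on top of
`…TangencyPolarityPG`; no definitions.
-/

-- `Summit.MatrixMultiplication.MatrixMultiplication.…` is the tree's mandated summit/problem namespace (D-0017).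
set_option linter.dupNamespace false

namespace Summit.MatrixMultiplication.MatrixMultiplication.Theorems.LevelOneGL2Designs.BaerPolarity

open Finset Matrix

/-- **The polar form of `stub_tangencySets` is false.**  There is no `c > 0` such that for
every `p₀` some prime `p ≥ p₀` carries a strong representative system of `AG(2,p)` in the stub's
normal form, of size `≥ c·p^{3/2}`, whose lines are the polars of its points with respect to a
non-degenerate symmetric matrix `G` (`(b,−1) ∥ G(a,1)`): such a system has at most `p + 1` flags
(`polar_srs_card_le_zmod`, from Baer's theorem), and `c·p^{3/2} ≤ p + 1 ≤ 2p` forces `p ≤ 4/c²`.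
[elementary, from Baer1946PolaritiesFiniteProjectivePlanes Thm 6 via `polar_srs_card_le_zmod`] -/
theorem not_polar_tangencySets :
    ¬ ∃ c : ℝ, 0 < c ∧ ∀ p₀ : ℕ, ∃ (p : ℕ) (_ : Fact p.Prime), p₀ ≤ p ∧
      ∃ (G : Matrix (Fin 3) (Fin 3) (ZMod p)) (S : Finset ((Fin 2 → ZMod p) × (Fin 2 → ZMod p))),
        G.IsSymm ∧ G.det ≠ 0 ∧ c * (p : ℝ) ^ (3 / 2 : ℝ) ≤ S.card ∧
        (∀ f ∈ S, ∀ f' ∈ S, (dotProduct f.1 f'.2 = 1 ↔ f = f')) ∧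
        (∀ f ∈ S, ∃ t : ZMod p, t ≠ 0 ∧
          (![f.2 0, f.2 1, -1] : Fin 3 → ZMod p) = t • (G *ᵥ ![f.1 0, f.1 1, 1])) := by
  rintro ⟨c, hc, h⟩
  obtain ⟨p, hp, hp₀, G, S, hG, hGdet, hcard, hS, hpolar⟩ := h (Nat.ceil (4 / c ^ 2) + 1)
  have hSle : (S.card : ℝ) ≤ p + 1 := by
    exact_mod_cast polar_srs_card_le_zmod p G hG hGdet S hS hpolar
  have hp1 : (1 : ℝ) ≤ p := by exact_mod_cast hp.out.one_le
  have hp0 : (0 : ℝ) < p := by linarith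
  have hsplit : (p : ℝ) ^ (3 / 2 : ℝ) = p * Real.sqrt p := by
    rw [show (3 / 2 : ℝ) = 1 + 1 / 2 by norm_num, Real.rpow_add hp0, Real.rpow_one,
      Real.sqrt_eq_rpow]
  -- `c·p·√p ≤ p + 1 ≤ 2p`, so `c·√p ≤ 2`
  have h1 : c * Real.sqrt p ≤ 2 := by
    have h' : (p : ℝ) * (c * Real.sqrt p) ≤ p * 2 := by
      have : c * ((p : ℝ) * Real.sqrt p) ≤ 2 * p := by rw [← hsplit]; linarith
      nlinarith [this]
    exact le_of_mul_le_mul_left h' hp0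
  -- so `p ≤ 4/c²`
  have h2 : (p : ℝ) ≤ 4 / c ^ 2 := by
    have hs : Real.sqrt p ≤ 2 / c := by
      rw [le_div_iff₀ hc]
      linarith [mul_comm c (Real.sqrt p)]
    have hsq : (Real.sqrt p) ^ 2 ≤ (2 / c) ^ 2 := pow_le_pow_left₀ (Real.sqrt_nonneg _) hs 2
    rw [Real.sq_sqrt hp0.le] at hsq
    calc (p : ℝ) ≤ (2 / c) ^ 2 := hsq
      _ = 4 / c ^ 2 := by ring
  -- but `p ≥ ⌈4/c²⌉ + 1`
  have h3 : (4 / c ^ 2 : ℝ) < p := by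
    have h4 := Nat.le_ceil (4 / c ^ 2)
    have h5 : ((Nat.ceil (4 / c ^ 2) : ℕ) : ℝ) + 1 ≤ p := by exact_mod_cast hp₀
    linarith
  linarith

end Summit.MatrixMultiplication.MatrixMultiplication.Theorems.LevelOneGL2Designs.BaerPolarity
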